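import Literature.Computability.QuantumComplexity.CircuitEmbedding
import Literature.Computability.QuantumComplexity.ReversibleCliffordT
import HarnessLib

/-!
# Conjugating a placed gate by a wire permutation; padded blocks; Born weights of one factor

Infrastructure for circuits that run a given sub-circuit *at a fixed position* — the front wires
`0 … k-1`, where its description is the given one verbatim — on data held elsewhere, by
conjugating it with a classical swap of wire blocks (trunk `CryptoQuantFine` model of
`QuantumCircuit.lean`; used by the wrapped family of `CWrapLayout.lean`, which must print the
circuits of an arbitrary uniform family inside its own and cannot re-index their descriptions):

* `placeGate_mulVec_basisState_apply` — a placed operator on a basis state, entrywise;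
* **`conj_placeGate_of_perm`** — if `Π` permutes basis states along a wire involution `τ`
  (`Π |w⟩ = |w ∘ τ⟩`, e.g. the compilation of three `CNOT`s per swapped pair,
  `RevMux.swapOps`), then `Π (placeGate E U) Π = placeGate (E ∘ τ) U`: conjugation by the
  swap transports the operator to the swapped wires (Nielsen–Chuang 2010, §4.3: a gate on a
  subset of the wires is `U ⊗ 1` up to the ordering of the tensor factors, §1.3.4: the swap);
* `toMatrix_flatMap_congr` — concatenations of circuit pieces with equal matrices have equal
  matrices;
* **padded blocks**: a circuit on `k` wires embedded in the first `k` of `b ≥ k` wires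
  (`Fin.castLEEmb`), applied to a basis state whose wires `≥ k` are `0`, has amplitudes
  `U (x|_k) (w|_k)` on the `x` that are `0` beyond `k` and `0` elsewhere
  (`placeGate_castLE_mulVec_basisState`), so the Born weight of an event read off the first `k`
  wires is the Born weight of the `k`-wire circuit (`sum_normSq_placeGate_castLE`, for any
  basis content of the other wires);
* `sum_prod_mul_eq` — **Born weights of a product distribution against a function of one
  factor**: `∑_y (∏ᵢ aᵢ(yᵢ)) G(y_j) = ∑_v a_j(v) G(v)` when every other factor sums to `1`
  (Nielsen–Chuang 2010, §2.2.8: measuring one register of a product state).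

## References

* M. A. Nielsen, I. L. Chuang, *Quantum Computation and Quantum Information*, CUP 2010,
  §1.3.4 (swap), §2.1.7 and §2.2.8 (tensor products, composite systems), §4.3 (a gate on a
  subset of the wires).
-/

noncomputable section

namespace Literature.Computability.QuantumComplexity

open Matrix Cryptography Finset

variable {N k b : ℕ}

/-! ### Placed operators on basis states -/

/-- **A placed operator on a basis state, entrywise**: the amplitude of `x` is `U (x|_E) (w|_E)`
if `x` agrees with `w` off the wires of `E`, else `0`. [cite: NielsenChuang2010, §4.3] -/
theorem placeGate_mulVec_basisState_apply (E : Fin k ↪ Fin N) (U : Matrix (QReg k) (QReg k) ℂ) (w x : QReg N) :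
    (placeGate E U *ᵥ basisState w) x = if (∀ i, i ∉ Set.range E → x i = w i) then U (x ∘ E) (w ∘ E) else 0 := by
  rw [mulVec_basisState]
  rfl

/-! ### Conjugation by a wire involution -/

/-- Composition with a wire involution is an injective self-map of the basis labels.
[folklore] -/
def compInvol (τ : Fin N → Fin N) (hτ : ∀ i, τ (τ i) = i) : QReg N ↪ QReg N :=
  ⟨fun w => w ∘ τ, fun w w' h => by
    funext i
    have := congrFun h (τ i)
    simpa [Function.comp, hτ] using this⟩

/-- `compInvol` applied. [folklore] -/
@[simp] theorem compInvol_apply (τ : Fin N → Fin N) (hτ : ∀ i, τ (τ i) = i) (w : QReg N) :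
    compInvol τ hτ w = w ∘ τ := rfl

/-- The inverse of `compInvol` (as a finite self-bijection) is itself. [folklore] -/
theorem compInvol_symm_apply (τ : Fin N → Fin N) (hτ : ∀ i, τ (τ i) = i) (y : QReg N) :
    (compInvol τ hτ).equivOfFiniteSelfEmbedding.symm y = y ∘ τ := by
  apply (compInvol τ hτ).equivOfFiniteSelfEmbedding.injective
  rw [Equiv.apply_symm_apply]
  change y = (y ∘ τ) ∘ τ
  funext i
  simp [Function.comp, hτ]

/-- The wire involution as an embedding. [folklore] -/
def invEmb (τ : Fin N → Fin N) (hτ : ∀ i, τ (τ i) = i) : Fin N ↪ Fin N :=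
  ⟨τ, fun i j h => by rw [← hτ i, h, hτ]⟩

/-- `invEmb` applied. [folklore] -/
@[simp] theorem invEmb_apply (τ : Fin N → Fin N) (hτ : ∀ i, τ (τ i) = i) (i : Fin N) : invEmb τ hτ i = τ i := rfl

/-- **Conjugating a placed operator by a wire involution.** If `Π` permutes the basis states
along the wire involution `τ` (`Π |w⟩ = |w ∘ τ⟩`), then `Π · placeGate E U · Π` is `U` placed
on the wires `τ ∘ E`. [cite: NielsenChuang2010, §4.3 (a gate on a subset of the wires is U ⊗ 1 up to the order of the factors)] -/
theorem conj_placeGate_of_perm (τ : Fin N → Fin N) (hτ : ∀ i, τ (τ i) = i)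
    {Pm : Matrix (QReg N) (QReg N) ℂ} (hPm : ∀ w, Pm *ᵥ basisState w = basisState (w ∘ τ))
    (E : Fin k ↪ Fin N) (U : Matrix (QReg k) (QReg k) ℂ) :
    Pm * placeGate E U * Pm = placeGate (E.trans (invEmb τ hτ)) U := by
  -- equality of matrices from equality on basis states
  have key : ∀ w, (Pm * placeGate E U * Pm) *ᵥ basisState w = placeGate (E.trans (invEmb τ hτ)) U *ᵥ basisState w := by
    intro w
    rw [← Matrix.mulVec_mulVec, ← Matrix.mulVec_mulVec, hPm w,
      mulVec_eq_of_perm (compInvol τ hτ) (fun z => hPm z) (placeGate E U *ᵥ basisState (w ∘ τ))]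
    funext v
    rw [compInvol_symm_apply, placeGate_mulVec_basisState_apply, placeGate_mulVec_basisState_apply]
    have hrange : ∀ j, (j ∉ Set.range (E.trans (invEmb τ hτ))) ↔ τ j ∉ Set.range E := by
      intro j
      simp only [Set.mem_range, Function.Embedding.trans_apply, invEmb_apply, not_exists]
      constructor
      · intro h i hi; exact h i (by rw [hi, hτ])
      · intro h i hi; exact h i (by rw [← hi, hτ])
    have hcond : (∀ i, i ∉ Set.range E → (v ∘ τ) i = (w ∘ τ) i) ↔ ∀ j, j ∉ Set.range (E.trans (invEmb τ hτ)) → v j = w j := by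
      constructor
      · intro h j hj
        have := h (τ j) ((hrange j).1 hj)
        simpa [Function.comp, hτ] using this
      · intro h i hi
        have := h (τ i) ((hrange (τ i)).2 (by rw [hτ]; exact hi))
        simpa [Function.comp] using this
    by_cases hc : ∀ i, i ∉ Set.range E → (v ∘ τ) i = (w ∘ τ) i
    · rw [if_pos hc, if_pos (hcond.1 hc)]
      rfl
    · rw [if_neg hc, if_neg (fun h => hc (hcond.2 h))]
  ext v w
  have h1 := congrFun (key w) v
  rwa [mulVec_basisState, mulVec_basisState] at h1

/-- **Circuit form.** If the compiled swap `S` permutes basis states along the wire involution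
`τ`, then `S ++ (C placed on E) ++ S` computes `C` placed on `τ ∘ E`. [cite: NielsenChuang2010, §4.3 (a gate on a subset of the wires is U ⊗ 1 up to the order of the factors)] -/
theorem toMatrix_conj_mapWires {G : QGateSet} (A : Language Bool) (τ : Fin N → Fin N) (hτ : ∀ i, τ (τ i) = i)
    (S : List (QGate G N)) (hS : ∀ w, (⟨S⟩ : QCircuit G N).toMatrix A *ᵥ basisState w = basisState (w ∘ τ))
    (E : Fin k ↪ Fin N) (C : QCircuit G k) :
    (⟨S ++ ((mapWires E C).gates ++ S)⟩ : QCircuit G N).toMatrix A = (mapWires (E.trans (invEmb τ hτ)) C).toMatrix A := by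
  have h1 : (⟨S ++ ((mapWires E C).gates ++ S)⟩ : QCircuit G N) =
      (⟨S⟩ : QCircuit G N).append ((mapWires E C).append ⟨S⟩) := rfl
  rw [h1, QCircuit.toMatrix_append, QCircuit.toMatrix_append, toMatrix_mapWires, toMatrix_mapWires]
  exact conj_placeGate_of_perm τ hτ hS E _

/-! ### Concatenations with equal matrices -/

/-- Pieces with equal matrices concatenate to circuits with equal matrices. [folklore] -/
theorem toMatrix_flatMap_congr {G : QGateSet} {α : Type*} (A : Language Bool) (l : List α)
    (f g : α → List (QGate G N)) (h : ∀ a ∈ l, (⟨f a⟩ : QCircuit G N).toMatrix A = (⟨g a⟩ : QCircuit G N).toMatrix A) :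
    (⟨l.flatMap f⟩ : QCircuit G N).toMatrix A = (⟨l.flatMap g⟩ : QCircuit G N).toMatrix A := by
  induction l with
  | nil => rfl
  | cons a l ih =>
    have e1 : (⟨(a :: l).flatMap f⟩ : QCircuit G N) = (⟨f a⟩ : QCircuit G N).append ⟨l.flatMap f⟩ := rfl
    have e2 : (⟨(a :: l).flatMap g⟩ : QCircuit G N) = (⟨g a⟩ : QCircuit G N).append ⟨l.flatMap g⟩ := rfl
    rw [e1, e2, QCircuit.toMatrix_append, QCircuit.toMatrix_append, h a (by simp),
      ih (fun a' ha' => h a' (List.mem_cons_of_mem _ ha'))]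

/-! ### Padded blocks: a circuit on the first `k` of `b` wires -/

/-- Off the first `k` wires means `k ≤ i`. [folklore] -/
theorem not_mem_range_castLEEmb_iff (hkb : k ≤ b) (i : Fin b) : i ∉ Set.range (Fin.castLEEmb hkb) ↔ k ≤ (i : ℕ) := by
  constructor
  · intro h
    by_contra hlt
    exact h ⟨⟨i, Nat.lt_of_not_le hlt⟩, Fin.ext rfl⟩
  · rintro h ⟨j, rfl⟩
    exact absurd j.isLt (Nat.not_lt.2 h)

/-- **A circuit on the first `k` wires applied to a basis state that is `0` beyond `k`**: the
amplitude of `x` is `U (x|_k) (w|_k)` if `x` is `0` beyond `k`, else `0`. [cite: NielsenChuang2010, §4.3] -/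
theorem placeGate_castLE_mulVec_basisState (hkb : k ≤ b) (U : Matrix (QReg k) (QReg k) ℂ) (w : QReg b)
    (hw : ∀ i : Fin b, k ≤ (i : ℕ) → w i = false) (x : QReg b) :
    (placeGate (Fin.castLEEmb hkb) U *ᵥ basisState w) x =
      if (∀ i : Fin b, k ≤ (i : ℕ) → x i = false) then U (x ∘ Fin.castLEEmb hkb) (w ∘ Fin.castLEEmb hkb) else 0 := by
  rw [placeGate_mulVec_basisState_apply]
  have hc : (∀ i, i ∉ Set.range (Fin.castLEEmb hkb) → x i = w i) ↔ ∀ i : Fin b, k ≤ (i : ℕ) → x i = false := by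
    constructor
    · intro h i hi; rw [h i ((not_mem_range_castLEEmb_iff hkb i).2 hi), hw i hi]
    · intro h i hi
      have hi' := (not_mem_range_castLEEmb_iff hkb i).1 hi
      rw [h i hi', hw i hi']
  by_cases h : ∀ i : Fin b, k ≤ (i : ℕ) → x i = false
  · rw [if_pos h, if_pos (hc.2 h)]
  · rw [if_neg h, if_neg (fun h' => h (hc.1 h'))]

/-- **Born weight of an event on the first `k` wires of a padded block** = Born weight of the
`k`-wire circuit. [cite: NielsenChuang2010, §2.2.8 (measurement of one register of a product state)] -/
theorem sum_normSq_placeGate_castLE (hkb : k ≤ b) (U : Matrix (QReg k) (QReg k) ℂ) (w : QReg b)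
    (T : QReg k → Prop) [DecidablePred T] :
    (∑ x : QReg b, if T (x ∘ Fin.castLEEmb hkb) then ‖(placeGate (Fin.castLEEmb hkb) U *ᵥ basisState w) x‖ ^ 2 else 0) =
      ∑ u : QReg k, if T u then ‖U u (w ∘ Fin.castLEEmb hkb)‖ ^ 2 else 0 := by
  classical
  have hterm : ∀ x : QReg b,
      (if T (x ∘ Fin.castLEEmb hkb) then ‖(placeGate (Fin.castLEEmb hkb) U *ᵥ basisState w) x‖ ^ 2 else 0) =
        if (∀ i, i ∉ Set.range (Fin.castLEEmb hkb) → x i = w i) then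
          (if T (x ∘ Fin.castLEEmb hkb) then ‖U (x ∘ Fin.castLEEmb hkb) (w ∘ Fin.castLEEmb hkb)‖ ^ 2 else 0) else 0 := by
    intro x
    rw [placeGate_mulVec_basisState_apply]
    by_cases hc : ∀ i, i ∉ Set.range (Fin.castLEEmb hkb) → x i = w i
    · rw [if_pos hc, if_pos hc]
    · rw [if_neg hc, if_neg hc]; simp
  simp_rw [hterm]
  rw [sum_ite_agree_eq_sum_extend]
  refine Finset.sum_congr rfl fun u _ => ?_
  rw [extend_comp_embedding]

/-! ### Born weights of a product distribution against a function of one factor -/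

/-- **Measuring one register of a product distribution**: if every factor but the `j`-th has
total weight `1`, then `∑_y (∏ᵢ aᵢ(yᵢ)) G(y_j) = ∑_v a_j(v) G(v)`. [cite: NielsenChuang2010, §2.2.8 (measurement of one register of a product state)] -/
theorem sum_prod_mul_eq {m : ℕ} {β : Type*} [Fintype β] [DecidableEq β] (a : Fin m → β → ℝ) (j : Fin m)
    (ha : ∀ i, i ≠ j → ∑ v, a i v = 1) (G : β → ℝ) :
    (∑ y : Fin m → β, (∏ i, a i (y i)) * G (y j)) = ∑ v, a j v * G v := by
  classical
  -- fold `G` into the `j`-th factor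
  let a' : Fin m → β → ℝ := Function.update a j (fun v => a j v * G v)
  have hfold : ∀ y : Fin m → β, (∏ i, a i (y i)) * G (y j) = ∏ i, a' i (y i) := by
    intro y
    rw [← Finset.mul_prod_erase _ _ (Finset.mem_univ j), ← Finset.mul_prod_erase Finset.univ (fun i => a' i (y i)) (Finset.mem_univ j)]
    have hrest : ∏ i ∈ Finset.univ.erase j, a' i (y i) = ∏ i ∈ Finset.univ.erase j, a i (y i) :=
      Finset.prod_congr rfl fun i hi => by simp [a', Function.update_of_ne (Finset.ne_of_mem_erase hi)]
    rw [hrest]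
    simp only [a', Function.update_self]
    ring
  simp_rw [hfold]
  have hswap : (∑ y : Fin m → β, ∏ i, a' i (y i)) = ∏ i, ∑ v, a' i v := by
    rw [Finset.prod_univ_sum (t := fun _ => Finset.univ) (f := fun i v => a' i v)]
    simp only [Fintype.piFinset_univ]
  rw [hswap, ← Finset.mul_prod_erase _ _ (Finset.mem_univ j)]
  have hone : ∏ i ∈ Finset.univ.erase j, ∑ v, a' i v = 1 :=
    Finset.prod_eq_one fun i hi => by
      have hij : i ≠ j := Finset.ne_of_mem_erase hi
      simp only [a', Function.update_of_ne hij]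
      exact ha i hij
  rw [hone, mul_one]
  simp [a']

end Literature.Computability.QuantumComplexity

end
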